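import Summits.ResolutionOfSingularities.ResolutionOfSingularities.Theorems.PurelyInseparableDim4Equivariance
import Summits.ResolutionOfSingularities.ResolutionOfSingularities.Theorems.PurelyInseparableDim4EquivarianceSym
import HarnessLib
import HarnessLib.Audit.Tags

/-!
# Purely inseparable fourfolds — a trap certificate MODULO `S₄` is a trap of the orbit union
# [OURS · counted 0 · a statement about OUR frame (`PurelyInseparableDim4Rules`), not about resolution]

Census cell «res-dim4-pi» (D-0157 DOOR 2), width seat `res-dim4-p-14`, brick PR-12h (crit-3
AUDIT-A3-02's ask, for the W3-13 kernel batch of the trap census).  The engines' trap certificates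
(eng-w5 `traps.jsonl`) list `S₄`-CANONICAL states: a recorded B-reply reaches the listed child only up
to a renaming of the four variables.  Such a list is NOT literally an `IsTrap` set, but — by p-6's
equivariance of the frame (`PurelyInseparableDim4Equivariance`: `Equivariance.edge_rename`,
`isPermissibleCentre_rename_iff`, `ordAlong_rename`) — the UNION OF THE `S₄`-ORBITS of its states is:

* (p-6's `Equivariance.rename_trans` from `…EquivarianceSym` is reused);
* **`isTrap_orbitUnion_of_modPerm`**: if every listed state is `q`-fold and every permissible centre
  has an edge to SOME renaming of a listed state, then `{s.rename e : s ∈ T, e ∈ S₄}` is an `IsTrap` set;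
* `not_terminatesSomeRule_of_modPerm` — hence a nonempty certificate modulo `S₄` over one field of
  characteristic `p` refutes `TerminatesSomeRule p q` exactly like a literal one.

DEF-FREE (the «mod `S₄`» hypothesis is spelled out).  Nothing here proves resolution of singularities
in dimension ≥ 4 / characteristic `p`; counted 0; AI work, weaker than expert review.
bears_on: LADDER-RESOLUTION:D157-DOOR2 (res-dim4-pi · PR-12h · W3-13). Supports
stmt-ResolutionOfSingularities-16155 (helper).
-/

set_option linter.dupNamespace false

noncomputable section

namespace Summit.ResolutionOfSingularities.ResolutionOfSingularities.Theorems.PIDim4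

namespace TrapModPerm

open Literature.AlgebraicGeometry.Resolution

variable {K : Type} [Field K] [DecidableEq K]

/-- **A trap certificate modulo `S₄` makes the orbit union a trap.**  Hypothesis: every state of `T`
is `q`-fold, and from every state every permissible coordinate centre has an edge to some RENAMING of a
state of `T`.  Conclusion: `{s.rename e : s ∈ T, e ∈ S₄}` is an `IsTrap` set (player B re-labels and
continues). [folklore] -/
theorem isTrap_orbitUnion_of_modPerm (q : ℕ) {T : Set (State K)}
    (hT : ∀ s ∈ T, (q : ℕ∞) ≤ CentreBlowup.ordAlong Finset.univ s.F ∧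
      ∀ S, IsPermissibleCentre q S s.F →
        ∃ s' : State K, Edge q S s s' ∧ ∃ e : Equiv.Perm (Fin 4), s'.rename e ∈ T) :
    IsTrap q {t : State K | ∃ e : Equiv.Perm (Fin 4), ∃ s ∈ T, t = s.rename e} := by
  rintro _ ⟨e, s, hs, rfl⟩
  obtain ⟨hord, hall⟩ := hT s hs
  refine ⟨?_, fun S'' hS'' => ?_⟩
  · rw [Equivariance.rename_F, ← Finset.map_univ_equiv e, Equivariance.ordAlong_rename]
    exact hord
  · have hperm : IsPermissibleCentre q (S''.map e.symm.toEmbedding) s.F := by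
      rw [← Equivariance.isPermissibleCentre_rename_iff e, Equivariance.map_symm_map]
      exact hS''
    obtain ⟨s', hedge, e', hs'⟩ := hall _ hperm
    refine ⟨s'.rename e, ⟨e'.symm.trans e, s'.rename e', hs', ?_⟩, ?_⟩
    · rw [Equivariance.rename_trans, ← Equiv.trans_assoc, Equiv.self_trans_symm, Equiv.refl_trans]
    · have h := Equivariance.edge_rename e hedge
      rwa [Equivariance.map_symm_map] at h

omit [DecidableEq K] in
/-- The orbit union contains the list (identity renaming), so it is nonempty when the list is.
[folklore] -/
theorem nonempty_orbitUnion {T : Set (State K)} (hne : T.Nonempty) :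
    ({t : State K | ∃ e : Equiv.Perm (Fin 4), ∃ s ∈ T, t = s.rename e} : Set (State K)).Nonempty := by
  obtain ⟨s, hs⟩ := hne
  refine ⟨s.rename (Equiv.refl _), Equiv.refl _, s, hs, rfl⟩

/-- **A nonempty trap certificate modulo `S₄` over one field of characteristic `p` refutes
`TerminatesSomeRule p q`** (every permissible rule over that field has an infinite branch).
[folklore] -/
theorem not_terminatesSomeRule_of_modPerm (p q : ℕ) (K : Type) [Field K] [CharP K p] [DecidableEq K]
    {T : Set (State K)} (hne : T.Nonempty)
    (hT : ∀ s ∈ T, (q : ℕ∞) ≤ CentreBlowup.ordAlong Finset.univ s.F ∧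
      ∀ S, IsPermissibleCentre q S s.F →
        ∃ s' : State K, Edge q S s s' ∧ ∃ e : Equiv.Perm (Fin 4), s'.rename e ∈ T) :
    ¬ TerminatesSomeRule p q :=
  not_terminatesSomeRule_of_trap p q K _ (isTrap_orbitUnion_of_modPerm q hT) (nonempty_orbitUnion hne)

/-- Rule form: under the same hypothesis no permissible rule over `K` terminates. [folklore] -/
theorem not_terminatesUnder_of_modPerm (q : ℕ) {T : Set (State K)} (hne : T.Nonempty)
    (hT : ∀ s ∈ T, (q : ℕ∞) ≤ CentreBlowup.ordAlong Finset.univ s.F ∧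
      ∀ S, IsPermissibleCentre q S s.F →
        ∃ s' : State K, Edge q S s s' ∧ ∃ e : Equiv.Perm (Fin 4), s'.rename e ∈ T)
    (R : CentreRule K) (hR : IsPermissibleRule q R) : ¬ TerminatesUnder q R :=
  not_terminatesUnder_of_trap q _ (isTrap_orbitUnion_of_modPerm q hT) (nonempty_orbitUnion hne) R hR

end TrapModPerm

end Summit.ResolutionOfSingularities.ResolutionOfSingularities.Theorems.PIDim4

end
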